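import Summits.HodgeConjecture.HodgeConjecture.Theorems.Ring2AbelianAllAndreWeilFieldIsogenyAnchors
import Summits.HodgeConjecture.HodgeConjecture.Theorems.Ring2AbelianAllAndreWeilFieldDiscriminantTransport
import HarnessLib

/-!
# Ring 2 · AbelianAll — ANDRÉ AXIS, PART S-f: THE PENCIL STAYS ON THE `δ`-COMPONENT — Deligne's discriminant and the Rosati condition pass along
  an `E`-isogeny pair for the pulled-back polarization class (abelian-variety level), so on a compact pencil with a global `E`-action and a
  global polarization class through a chart `E`-isogenous to a `δ`-anchor `(A₀, η₀, h₀)` (part S-b), EVERY member carries the three member data of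
  the cell's typed target `WeilClassesComponentCM R e₀ k δ` — Weil type relative to `E`, Rosati-compatible, discriminant `δ` — and, granted `B⋆`
  of the ONE total space, the target's conclusion: all its `E`-Weil classes are algebraic (fact-free)

HONEST FRAMING (page 1, verbatim): **research route, not a corollary; conditional on HC_CM plus one named minimal statement.** Cell line:
research route conditional on HC_CM; not a corollary; Q11.4-sentence-2 already refuted in dim ≥ 3. Nothing in this file proves a case of the
Hodge conjecture or of `B(X)` for a named `X`, and `WeilClassesComponentCM R e₀ k δ` is NOT proved for any component: the rows are IMPLICATIONS
with displayed hypotheses about the members of ONE pencil. `HC_CM`, `HC_AV`, the global nodes and Verdier's binder do NOT occur. Item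
`Theses.RankFourFaces.CMToAbelian` (stmt-16267) stays OPEN; N104 untouched; no node is born (0 `def`, 0 `sorry`, no named fact). Seat
`pub-hodge-ring2-ab-andre-2`, gen 49 (part S; owed items (o156)/(o157)). Inputs: part S-a (`E`-isogeny transport of `W_E` and of Weil type; the
rows through an `E`-isogenous anchor), part S-e (Deligne's `disc φ` and the Rosati condition along transports and along the pencil), part R-c.

## Content (theorems only; standard axioms)

* §1 (AV level) `complexBetti_map_injective_of_comp_eq_nsmul` / `…_surjective_of_comp_eq_nsmul` — for `v ≫ u = n·𝟙` (`n ≥ 1`) the pull-back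
  `u^*` is injective in every degree, for `u ≫ v = n·𝟙` it is surjective (`[n]^* = nᵏ` on `Hᵏ` of an abelian variety).
  **`hasWeilDiscriminantCM_of_isogenyPair`** — `(A₀, η₀, h₀)` with a discriminant witness of class `δ`, `u : Y ⟶ A₀` with `u ≫ η₀ = ψ ≫ u`,
  `v ≫ u = n·𝟙_{A₀}`, `dim Y = dim A₀` ⟹ `(Y, ψ, u^* h₀)` has a discriminant witness of class `δ` (part S-e §1 with `T = u^*`; Deligne p. 30:
  `disc φ` is an invariant of the `E`-hermitian space, and an `E`-isogeny is an `E`-linear isometry of `(H¹(A₀, ℚ), u^*)`);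
  **`rosatiCompatible_of_isogenyPair`** — with `u ≫ v = n'·𝟙_Y` as well, the Rosati condition passes to `(Y, ψ, u^* h₀)`.
* §2 (pencils) **`hasWeilDiscriminantCM_member_of_isogenyPair_chart`**, **`rosatiCompatible_member_of_isogenyPair_chart`** — compact abelian
  pencil with a global endomorphism `Φ` over `S`, a global class `H ∈ H²(𝒳(ℂ); ℂ)` and `Φ`-compatible charts; at ONE member `s₀` an `E`-isogeny pair
  with an anchor `(A₀, η₀, h₀)` such that the restricted class on the chart is the pulled-back anchor class, `e_{s₀}^*(H|X_{s₀}) = u^* h₀`: the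
  discriminant class `δ` (resp. the Rosati condition) of the anchor holds for `(A_s, φ_s, e_s^*(H|X_s))` at EVERY member (§1, then part S-e).
* §3 **`componentData_member_of_isogenyPair_anchor`** — THE PENCIL STAYS ON THE COMPONENT: with the anchor of Weil type (`IsWeilTypeCM A₀ η₀ R e₀ k`),
  Rosati-compatible and of discriminant `δ`, and the flat-class data of part R-c (a rational global `U` on `W_E(A_t) ⊗ ℂ`, `U|X_t ≠ 0`), EVERY member
  `(A_s, φ_s, e_s^*(H|X_s))` is of Weil type relative to `E`, Rosati-compatible and of discriminant `δ` — the member data of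
  `Ring2.Hypotheses.WeilClassesComponentCM R e₀ k δ` (positivity apart). **`weilClassesField_le_algebraicClasses_and_componentData_member_of_lefschetzB`**
  — if moreover `B⋆(𝒳, η)` holds for every `η` and `W_E(A₀) ⊗ ℂ` is algebraic (ring2-b03's members: HC at the anchor), then at EVERY member the
  component data hold AND `W_E(A_s, φ_s) ⊗ ℂ ⊆ Nᵏ(A_s)` — the conclusion of `WeilClassesComponentCM R e₀ k δ` (indeed all of `W_E ⊗ ℂ`, not only
  its rational `(k,k)` part) for the members of this pencil.

## Honest status

Fact-free. What is NOT transported: positivity of the restricted class (`IsPolarizationClass` / Kähler — part L-b's member embeddings give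
polarization-type classes in the quadratic files; here the class is whatever global `H` is supplied); existence of the pencil, of the global
`E`-action and of the global class `H` matching the anchor's (hypotheses, as on the whole axis). The typed target `WeilClassesComponentCM R e₀ k δ`
quantifies over ALL polarized Weil-type `(A, η, h)` of the component; this file reaches those lying on a compact `E`-pencil through an anchored
chart whose one total space satisfies `B⋆` — the open input, unchanged. Nothing minimal claimed; N104 untouched. EDGE LABELS: all theorems K.
References: Deligne1982HodgeCycles (§4 p. 30, (4.4), Lemma 4.6, Remark 4.10, proof of Thm. 4.8 (pp. 56–61)); Landherr1936HermitianForms;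
MoonenZarhin1998WeilClasses (§1); Andre1996Motifs (§6.3 Lemme 6.3.3, Remarque 2); MumfordAV1970 (§1 (3), §19); vanGeemen1994HodgeAV (3.6, 4.14).
-/

noncomputable section

set_option linter.dupNamespace false

namespace Summit.HodgeConjecture.HodgeConjecture.Ring2.AbelianAll

open CategoryTheory AlgebraicGeometry Polynomial
open Literature.AlgebraicGeometry Literature.AlgebraicGeometry.Motives
open Literature.AlgebraicGeometry.HodgeTheory Literature.AlgebraicGeometry.VanGeemen1994 Literature.AlgebraicGeometry.Deligne1982
open Literature.AlgebraicTopology.SingularHomology (singularCohomology)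
open Summit.HodgeConjecture.HodgeConjecture.Ring2.Hypotheses (RosatiCompatible)

/-! ## §1 AV level: the discriminant and the Rosati condition along an `E`-isogeny pair -/

section AVLevel

variable {A₀ Y : AbelianVariety ℂ} {η₀ : A₀ ⟶ A₀} {ψ : Y ⟶ Y}

/-- `u^*` is injective on every `Hᵏ` when `v ≫ u = n·𝟙` with `n ≥ 1` (`v^* u^* = [n]^* = nᵏ`). [cite: MumfordAV1970, §1 (3) and §19] -/
theorem complexBetti_map_injective_of_comp_eq_nsmul {u : Y ⟶ A₀} {v : A₀ ⟶ Y} {n : ℕ} (hn : 0 < n) (hvu : v ≫ u = n • 𝟙 A₀) (k : ℕ) :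
    Function.Injective (complexBetti.map u.hom.hom.hom k) := by
  intro c c' hcc'
  have e : ∀ z : complexBetti A₀.X k, complexBetti.map v.hom.hom.hom k (complexBetti.map u.hom.hom.hom k z) = ((n : ℂ) ^ k) • z := by
    intro z
    change singularCohomology.map ℂ ℂ (Motives.AlgPoints.mapContinuous (L := ℂ) v.hom.hom.hom) k
      (singularCohomology.map ℂ ℂ (Motives.AlgPoints.mapContinuous (L := ℂ) u.hom.hom.hom) k z) = _
    rw [abelianVarietyHom_map_map_apply, hvu]
    exact complexBetti_map_nsmul_id_apply A₀ n k z
  have h := congrArg (complexBetti.map v.hom.hom.hom k) hcc'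
  rw [e, e] at h
  exact smul_right_injective _ (pow_ne_zero _ (Nat.cast_ne_zero.2 hn.ne')) h

/-- `u^*` is surjective on every `Hᵏ` when `u ≫ v = n·𝟙` with `n ≥ 1` (`u^* v^* = [n]^* = nᵏ`). [cite: MumfordAV1970, §1 (3) and §19] -/
theorem complexBetti_map_surjective_of_comp_eq_nsmul {u : Y ⟶ A₀} {v : A₀ ⟶ Y} {n : ℕ} (hn : 0 < n) (huv : u ≫ v = n • 𝟙 Y) (k : ℕ) :
    Function.Surjective (complexBetti.map u.hom.hom.hom k) := by
  intro c
  refine ⟨((n : ℂ) ^ k)⁻¹ • complexBetti.map v.hom.hom.hom k c, ?_⟩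
  rw [map_smul]
  change ((n : ℂ) ^ k)⁻¹ • singularCohomology.map ℂ ℂ (Motives.AlgPoints.mapContinuous (L := ℂ) u.hom.hom.hom) k
    (singularCohomology.map ℂ ℂ (Motives.AlgPoints.mapContinuous (L := ℂ) v.hom.hom.hom) k c) = c
  rw [abelianVarietyHom_map_map_apply, huv]
  change ((n : ℂ) ^ k)⁻¹ • complexBetti.map (n • 𝟙 Y).hom.hom.hom k c = c
  rw [complexBetti_map_nsmul_id_apply Y n k c, smul_smul, inv_mul_cancel₀ (pow_ne_zero _ (Nat.cast_ne_zero.2 hn.ne')), one_smul]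

variable {R : Polynomial ℤ} [Fact (Irreducible (realPolyQ R))] {e₀ k : ℕ} {h₀ : complexBetti A₀.X 2}

/-- **DELIGNE'S DISCRIMINANT PASSES ALONG AN `E`-ISOGENY PAIR, for the pulled-back polarization class.** If `(A₀, η₀, h₀)` has a discriminant
witness of class `δ ∈ E⁺ˣ/N(Eˣ)` (`HasWeilDiscriminantCM A₀ η₀ R e₀ k h₀ δ`) and `u : Y ⟶ A₀` intertwines (`u ≫ η₀ = ψ ≫ u`) with `v ≫ u = n·𝟙_{A₀}`
(`n ≥ 1`) and `dim Y = dim A₀`, then `(Y, ψ, u^* h₀)` has a discriminant witness of class `δ`: part S-e's transport with `T = u^*` in degrees `1` and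
`2 + 2(dim A₀ - 1)` (injective, rational, `η`-equivariant, and `u^* Q_{h₀}(x, y) = Q_{u^* h₀}(u^* x, u^* y)`). In print: `disc φ` is an invariant of
the `E`-hermitian space `H₁(A, ℚ)`, which an `E`-isogeny identifies. [cite: Deligne1982HodgeCycles, §4 p. 30 and Lemma 4.6] [cite: Landherr1936HermitianForms] -/
theorem hasWeilDiscriminantCM_of_isogenyPair {δ : cmNormResidueGroup R} (hdisc : HasWeilDiscriminantCM A₀ η₀ R e₀ k h₀ δ)
    (hdim : Y.dim = A₀.dim) {u : Y ⟶ A₀} {v : A₀ ⟶ Y} {n : ℕ} (hn : 0 < n) (hvu : v ≫ u = n • 𝟙 A₀) (hu : u ≫ η₀ = ψ ≫ u) :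
    HasWeilDiscriminantCM Y ψ R e₀ k (complexBetti.map u.hom.hom.hom 2 h₀) δ := by
  refine hasWeilDiscriminantCM_of_transport (A := A₀) (B := Y) (dA := A₀.dim) rfl hdim
    (complexBetti.map u.hom.hom.hom 1).hom (complexBetti.map u.hom.hom.hom (2 + 2 * (A₀.dim - 1))).hom
    (complexBetti_map_injective_of_comp_eq_nsmul hn hvu 1) (complexBetti_map_injective_of_comp_eq_nsmul hn hvu _)
    (fun x hx => hx.map _) (fun ω hω => hω.map _) (fun x => ?_) (fun x y => ?_) hdisc
  · change singularCohomology.map ℂ ℂ (Motives.AlgPoints.mapContinuous (L := ℂ) u.hom.hom.hom) 1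
        (singularCohomology.map ℂ ℂ (Motives.AlgPoints.mapContinuous (L := ℂ) η₀.hom.hom.hom) 1 x) =
      singularCohomology.map ℂ ℂ (Motives.AlgPoints.mapContinuous (L := ℂ) ψ.hom.hom.hom) 1
        (singularCohomology.map ℂ ℂ (Motives.AlgPoints.mapContinuous (L := ℂ) u.hom.hom.hom) 1 x)
    rw [abelianVarietyHom_map_map_apply, abelianVarietyHom_map_map_apply, hu]
  · exact map_polarizationPairingOne u.hom.hom.hom h₀ (A₀.dim - 1) x y

/-- **THE ROSATI CONDITION PASSES ALONG AN `E`-ISOGENY PAIR** (`u ≫ η₀ = ψ ≫ u`, `v ≫ u = n·𝟙_{A₀}`, `u ≫ v = n'·𝟙_Y`: `u^*` is bijective on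
`H¹`): `RosatiCompatible A₀ η₀ h₀ ⟹ RosatiCompatible Y ψ (u^* h₀)`. [cite: Deligne1982HodgeCycles, §4 p. 33 and Milne 2003 re-edition endnote 16] -/
theorem rosatiCompatible_of_isogenyPair (hros : RosatiCompatible A₀ η₀ h₀) (hdim : Y.dim = A₀.dim) {u : Y ⟶ A₀} {v : A₀ ⟶ Y}
    {n' : ℕ} (hn' : 0 < n') (huv : u ≫ v = n' • 𝟙 Y) (hu : u ≫ η₀ = ψ ≫ u) :
    RosatiCompatible Y ψ (complexBetti.map u.hom.hom.hom 2 h₀) := by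
  refine rosatiCompatible_of_transport (A := A₀) (B := Y) (dA := A₀.dim) rfl hdim
    (complexBetti.map u.hom.hom.hom 1).hom (complexBetti.map u.hom.hom.hom (2 + 2 * (A₀.dim - 1))).hom
    (complexBetti_map_surjective_of_comp_eq_nsmul hn' huv 1) (fun x => ?_) (fun x y => ?_) hros
  · change singularCohomology.map ℂ ℂ (Motives.AlgPoints.mapContinuous (L := ℂ) u.hom.hom.hom) 1
        (singularCohomology.map ℂ ℂ (Motives.AlgPoints.mapContinuous (L := ℂ) η₀.hom.hom.hom) 1 x) =
      singularCohomology.map ℂ ℂ (Motives.AlgPoints.mapContinuous (L := ℂ) ψ.hom.hom.hom) 1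
        (singularCohomology.map ℂ ℂ (Motives.AlgPoints.mapContinuous (L := ℂ) u.hom.hom.hom) 1 x)
    rw [abelianVarietyHom_map_map_apply, abelianVarietyHom_map_map_apply, hu]
  · exact map_polarizationPairingOne u.hom.hom.hom h₀ (A₀.dim - 1) x y

end AVLevel

/-! ## §2 Pencils: the anchor's discriminant class and Rosati condition at every member -/

section Pencil

variable {𝒳 S : SchemeOver ℂ} {f : 𝒳 ⟶ S} {d : ℕ} {R : Polynomial ℤ} [Fact (Irreducible (realPolyQ R))] {e₀ k : ℕ}

/-- **THE ANCHOR'S DISCRIMINANT CLASS AT EVERY MEMBER.** Compact pencil `f : 𝒳 ⟶ S` of abelian `d`-folds with a global endomorphism `Φ` over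
`S`, a global class `H ∈ H²(𝒳(ℂ); ℂ)` and `Φ`-compatible charts `(A_s, e_s, φ_s)`; an anchor `(A₀, η₀, h₀)` with a discriminant witness of class `δ`;
at ONE member `s₀`, `u : A_{s₀} ⟶ A₀` intertwining with `v ≫ u = n·𝟙_{A₀}`, `dim A_{s₀} = dim A₀`, and the restricted class IS the pulled-back
anchor class, `e_{s₀}^*(H|X_{s₀}) = u^* h₀`. Then `(A_s, φ_s, e_s^*(H|X_s))` has a discriminant witness of class `δ` for EVERY member `s` (§1 at `s₀`,
part S-e along the pencil). [cite: Deligne1982HodgeCycles, §4 p. 30 and proof of Thm. 4.8 (pp. 56–61)] [cite: Landherr1936HermitianForms] -/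
theorem hasWeilDiscriminantCM_member_of_isogenyPair_chart (hf : IsCompactAbelianPencil f d)
    (Φ : 𝒳 ⟶ 𝒳) (hΦ : Φ ≫ f = f) (H : complexBetti 𝒳 2)
    (A : ComplexPoints S → AbelianVariety ℂ) (e : ∀ s, (A s).X ≅ fiberOver f s) (φ : ∀ s, A s ⟶ A s)
    (hK : ∀ s, ∃ Φs : fiberOver f s ⟶ fiberOver f s, Φs ≫ fiberι f s = fiberι f s ≫ Φ ∧ (e s).hom ≫ Φs = (φ s).hom.hom.hom ≫ (e s).hom)
    {A₀ : AbelianVariety ℂ} {η₀ : A₀ ⟶ A₀} {h₀ : complexBetti A₀.X 2} {δ : cmNormResidueGroup R}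
    (hdisc : HasWeilDiscriminantCM A₀ η₀ R e₀ k h₀ δ)
    {s₀ : ComplexPoints S} (hdim : (A s₀).dim = A₀.dim) (u : A s₀ ⟶ A₀) (v : A₀ ⟶ A s₀) {n : ℕ} (hn : 0 < n)
    (hvu : v ≫ u = n • 𝟙 A₀) (hu : u ≫ η₀ = φ s₀ ≫ u)
    (hH₀ : complexBetti.map (e s₀).hom 2 (complexBetti.map (fiberι f s₀) 2 H) = complexBetti.map u.hom.hom.hom 2 h₀) (s : ComplexPoints S) :
    HasWeilDiscriminantCM (A s) (φ s) R e₀ k (complexBetti.map (e s).hom 2 (complexBetti.map (fiberι f s) 2 H)) δ := by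
  have h₀' : HasWeilDiscriminantCM (A s₀) (φ s₀) R e₀ k (complexBetti.map (e s₀).hom 2 (complexBetti.map (fiberι f s₀) 2 H)) δ := by
    rw [hH₀]
    exact hasWeilDiscriminantCM_of_isogenyPair hdisc hdim hn hvu hu
  exact (hasWeilDiscriminantCM_member_iff hf Φ hΦ H A e φ hK δ s₀ s).1 h₀'

/-- **THE ANCHOR'S ROSATI CONDITION AT EVERY MEMBER** (same setting; the pair with both composites `v ≫ u = n·𝟙`, `u ≫ v = n'·𝟙`).
[cite: Deligne1982HodgeCycles, §4 p. 33 and proof of Thm. 4.8 (pp. 56–61)] -/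
theorem rosatiCompatible_member_of_isogenyPair_chart (hf : IsCompactAbelianPencil f d)
    (Φ : 𝒳 ⟶ 𝒳) (hΦ : Φ ≫ f = f) (H : complexBetti 𝒳 2)
    (A : ComplexPoints S → AbelianVariety ℂ) (e : ∀ s, (A s).X ≅ fiberOver f s) (φ : ∀ s, A s ⟶ A s)
    (hK : ∀ s, ∃ Φs : fiberOver f s ⟶ fiberOver f s, Φs ≫ fiberι f s = fiberι f s ≫ Φ ∧ (e s).hom ≫ Φs = (φ s).hom.hom.hom ≫ (e s).hom)
    {A₀ : AbelianVariety ℂ} {η₀ : A₀ ⟶ A₀} {h₀ : complexBetti A₀.X 2} (hros : RosatiCompatible A₀ η₀ h₀)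
    {s₀ : ComplexPoints S} (hdim : (A s₀).dim = A₀.dim) (u : A s₀ ⟶ A₀) (v : A₀ ⟶ A s₀) {n' : ℕ} (hn' : 0 < n')
    (huv : u ≫ v = n' • 𝟙 (A s₀)) (hu : u ≫ η₀ = φ s₀ ≫ u)
    (hH₀ : complexBetti.map (e s₀).hom 2 (complexBetti.map (fiberι f s₀) 2 H) = complexBetti.map u.hom.hom.hom 2 h₀) (s : ComplexPoints S) :
    RosatiCompatible (A s) (φ s) (complexBetti.map (e s).hom 2 (complexBetti.map (fiberι f s) 2 H)) := by
  have h₀' : RosatiCompatible (A s₀) (φ s₀) (complexBetti.map (e s₀).hom 2 (complexBetti.map (fiberι f s₀) 2 H)) := by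
    rw [hH₀]
    exact rosatiCompatible_of_isogenyPair hros hdim hn' huv hu
  exact (rosatiCompatible_member_iff hf Φ hΦ H A e φ hK s₀ s).1 h₀'

/-! ## §3 The pencil stays on the `δ`-component; with `B⋆`, the component target's conclusion at every member -/

/-- **THE PENCIL STAYS ON THE `δ`-COMPONENT.** Compact pencil `f : 𝒳 ⟶ S` of abelian `d`-folds with a global endomorphism `Φ` over `S`, a global
class `H`, `Φ`-compatible charts `(A_s, e_s, φ_s)` with `R(φ_s²) = 0`, the flat-class data of part R-c (a rational global `U` with
`e_t^*(U|X_t) ∈ W_E(A_t) ⊗ ℂ`, `U|X_t ≠ 0`), and an ANCHOR `(A₀, η₀, h₀)` of Weil type relative to `E` (`IsWeilTypeCM A₀ η₀ R e₀ k`), Rosati-compatible,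
of discriminant `δ`, linked to ONE chart `A_{s₀}` by an `E`-isogeny pair (`u ≫ η₀ = φ_{s₀} ≫ u`, `v ≫ u = n·𝟙`, `u ≫ v = n'·𝟙`, `dim A_{s₀} = dim A₀`)
with `e_{s₀}^*(H|X_{s₀}) = u^* h₀`. Then EVERY member `(A_s, φ_s, e_s^*(H|X_s))` is of Weil type relative to `E`, Rosati-compatible and of
discriminant `δ` — the member data of the cell's typed target `WeilClassesComponentCM R e₀ k δ` (positivity of the class apart). No `B⋆`, no HC.
[cite: Deligne1982HodgeCycles, §4 (4.4), p. 30, Lemma 4.6 and proof of Thm. 4.8 (pp. 56–61)] [cite: MoonenZarhin1998WeilClasses, §1 (Criterion)] -/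
theorem componentData_member_of_isogenyPair_anchor (hf : IsCompactAbelianPencil f d)
    (Φ : 𝒳 ⟶ 𝒳) (hΦ : Φ ≫ f = f) (H : complexBetti 𝒳 2)
    (A : ComplexPoints S → AbelianVariety ℂ) (e : ∀ s, (A s).X ≅ fiberOver f s) (φ : ∀ s, A s ⟶ A s)
    (hK : ∀ s, ∃ Φs : fiberOver f s ⟶ fiberOver f s, Φs ≫ fiberι f s = fiberι f s ≫ Φ ∧ (e s).hom ≫ Φs = (φ s).hom.hom.hom ≫ (e s).hom)
    (hP : ∀ s, Polynomial.eval₂ (Int.castRingHom (CategoryTheory.End (A s))) ((φ s : CategoryTheory.End (A s)))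
      (R.comp (X ^ 2)) = 0)
    (U : complexBetti 𝒳 (2 * k)) (hUQ : IsRationalClass U) {t : ComplexPoints S}
    (hUt : complexBetti.map (e t).hom (2 * k) (complexBetti.map (fiberι f t) (2 * k) U) ∈
      weilClassesField (A t) (φ t) (R.comp (X ^ 2)) (2 * k))
    (hU0 : complexBetti.map (fiberι f t) (2 * k) U ≠ 0)
    {A₀ : AbelianVariety ℂ} {η₀ : A₀ ⟶ A₀} {h₀ : complexBetti A₀.X 2} {δ : cmNormResidueGroup R}
    (hW₀ : IsWeilTypeCM A₀ η₀ R e₀ k) (hros₀ : RosatiCompatible A₀ η₀ h₀) (hdisc₀ : HasWeilDiscriminantCM A₀ η₀ R e₀ k h₀ δ)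
    {s₀ : ComplexPoints S} (hdim : (A s₀).dim = A₀.dim) (u : A s₀ ⟶ A₀) (v : A₀ ⟶ A s₀) {n n' : ℕ} (hn : 0 < n) (hn' : 0 < n')
    (hvu : v ≫ u = n • 𝟙 A₀) (huv : u ≫ v = n' • 𝟙 (A s₀)) (hu : u ≫ η₀ = φ s₀ ≫ u)
    (hH₀ : complexBetti.map (e s₀).hom 2 (complexBetti.map (fiberι f s₀) 2 H) = complexBetti.map u.hom.hom.hom 2 h₀) (s : ComplexPoints S) :
    IsWeilTypeCM (A s) (φ s) R e₀ k ∧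
      RosatiCompatible (A s) (φ s) (complexBetti.map (e s).hom 2 (complexBetti.map (fiberι f s) 2 H)) ∧
      HasWeilDiscriminantCM (A s) (φ s) R e₀ k (complexBetti.map (e s).hom 2 (complexBetti.map (fiberι f s) 2 H)) δ :=
  ⟨isWeilTypeCM_member_of_isogenyPair_weilTypeCM_chart hf Φ hΦ A e φ hK hP U hUQ hUt hU0 hW₀ hdim u v hn hvu hu s,
    rosatiCompatible_member_of_isogenyPair_chart hf Φ hΦ H A e φ hK hros₀ hdim u v hn' huv hu hH₀ s,
    hasWeilDiscriminantCM_member_of_isogenyPair_chart hf Φ hΦ H A e φ hK hdisc₀ hdim u v hn hvu hu hH₀ s⟩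

/-- **WITH `B⋆` OF THE ONE TOTAL SPACE: THE COMPONENT TARGET'S CONCLUSION AT EVERY MEMBER.** In the setting of
`componentData_member_of_isogenyPair_anchor` on a pencil of relative dimension `2ke₀`, assume moreover `B⋆(𝒳, η)` for every `η`, that the anchor's
`E`-Weil classes are algebraic (`W_E(A₀) ⊗ ℂ ⊆ Nᵏ(A₀)` — ring2-b03's CM power members satisfy HC, part S-b), and that `v` intertwines
(`v ≫ φ_{s₀} = η₀ ≫ v`). Then at EVERY member: Weil type relative to `E`, Rosati-compatible, discriminant `δ`, AND `W_E(A_s, φ_s) ⊗ ℂ ⊆ Nᵏ(A_s)` — all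
of `W_E ⊗ ℂ`, in particular every rational `(k, k)` class in it: the conclusion of `WeilClassesComponentCM R e₀ k δ` for the members of this pencil
(fact-free; parts S-a §3 and §2 above). [cite: Deligne1982HodgeCycles, §4 (4.4), Lemma 4.6, Remark 4.10 and proof of Thm. 4.8]
[cite: MoonenZarhin1998WeilClasses, §1 (dim_F W_F = 1; Criterion)] [cite: Andre1996Motifs, §6.3 Lemme 6.3.3 and Remarque 2 (p. 33)] [cite: Andre2026, §4.4.4] -/
theorem weilClassesField_le_algebraicClasses_and_componentData_member_of_lefschetzB
    (hf : IsCompactAbelianPencil f (2 * k * e₀)) (hB : ∀ ηX : complexBetti 𝒳 2, StandardConjectureBStar (2 * k * e₀ + 1) 𝒳 ηX)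
    (Φ : 𝒳 ⟶ 𝒳) (hΦ : Φ ≫ f = f) (H : complexBetti 𝒳 2)
    (A : ComplexPoints S → AbelianVariety ℂ) (e : ∀ s, (A s).X ≅ fiberOver f s) (φ : ∀ s, A s ⟶ A s)
    (hK : ∀ s, ∃ Φs : fiberOver f s ⟶ fiberOver f s, Φs ≫ fiberι f s = fiberι f s ≫ Φ ∧ (e s).hom ≫ Φs = (φ s).hom.hom.hom ≫ (e s).hom)
    (hP : ∀ s, Polynomial.eval₂ (Int.castRingHom (CategoryTheory.End (A s))) ((φ s : CategoryTheory.End (A s)))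
      (R.comp (X ^ 2)) = 0)
    (U : complexBetti 𝒳 (2 * k)) (hUQ : IsRationalClass U) {t : ComplexPoints S}
    (hUt : complexBetti.map (e t).hom (2 * k) (complexBetti.map (fiberι f t) (2 * k) U) ∈
      weilClassesField (A t) (φ t) (R.comp (X ^ 2)) (2 * k))
    (hU0 : complexBetti.map (fiberι f t) (2 * k) U ≠ 0)
    {A₀ : AbelianVariety ℂ} {η₀ : A₀ ⟶ A₀} {h₀ : complexBetti A₀.X 2} {δ : cmNormResidueGroup R}
    (hW₀ : IsWeilTypeCM A₀ η₀ R e₀ k) (hros₀ : RosatiCompatible A₀ η₀ h₀) (hdisc₀ : HasWeilDiscriminantCM A₀ η₀ R e₀ k h₀ δ)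
    (halg₀ : weilClassesField A₀ η₀ (R.comp (X ^ 2)) (2 * k) ≤ algebraicClasses A₀.X k)
    {s₀ : ComplexPoints S} (hdim : (A s₀).dim = A₀.dim) (u : A s₀ ⟶ A₀) (v : A₀ ⟶ A s₀) {n n' : ℕ} (hn : 0 < n) (hn' : 0 < n')
    (hvu : v ≫ u = n • 𝟙 A₀) (huv : u ≫ v = n' • 𝟙 (A s₀)) (hu : u ≫ η₀ = φ s₀ ≫ u) (hv : v ≫ φ s₀ = η₀ ≫ v)
    (hH₀ : complexBetti.map (e s₀).hom 2 (complexBetti.map (fiberι f s₀) 2 H) = complexBetti.map u.hom.hom.hom 2 h₀) (s : ComplexPoints S) :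
    (IsWeilTypeCM (A s) (φ s) R e₀ k ∧
      RosatiCompatible (A s) (φ s) (complexBetti.map (e s).hom 2 (complexBetti.map (fiberι f s) 2 H)) ∧
      HasWeilDiscriminantCM (A s) (φ s) R e₀ k (complexBetti.map (e s).hom 2 (complexBetti.map (fiberι f s) 2 H)) δ) ∧
      weilClassesField (A s) (φ s) (R.comp (X ^ 2)) (2 * k) ≤ algebraicClasses (A s).X k :=
  ⟨componentData_member_of_isogenyPair_anchor hf Φ hΦ H A e φ hK hP U hUQ hUt hU0 hW₀ hros₀ hdisc₀ hdim u v hn hn' hvu huv hu hH₀ s,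
    weilClassesField_le_algebraicClasses_forall_of_lefschetzB_of_isogenyPair_chart hf hB Φ hΦ A e φ hK hW₀.natDegree_comp hW₀.irreducible hP
      (by ring) hW₀.k_pos U hUQ hUt hU0 halg₀ u v hn' huv hv s⟩

end Pencil

end Summit.HodgeConjecture.HodgeConjecture.Ring2.AbelianAll

end
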